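import Summits.HodgeConjecture.CorCM.Census.HalfParityLift
import Summits.HodgeConjecture.CorCM.Census.CoinvariantComplement

/-!
# The half-parity law, IX: the COCYCLE of an invariant functional — gradient, potential, correction, and the normal form
# `λ′∘Q − λ′ = e(Q)·mass`

COR-CM (cell `pub-hodgecm2`), count-neutral kernel combinatorics by the binder seat b09 (gen 31; lane DIRECT-FACTOR, sequel
«CLOSED-FORM LAW» = lit-andre-3ʼs ask A6-R55: the EQUALITY half of André-3ʼs law `φ₂ = β − 1 − δ + t`), part IX of the
HALF-PARITY series, sequel of `Census/HalfParityLift.lean` (VIII) and `Census/CoinvariantComplement.lean` (XII).  Four bookkeeping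
definitions with bodies (`mass`, `cob`, `cgrad`, `corr`) + theorems; no `Prop`-valued definition, no `decide` beyond closed
identities in `𝔽₂`, no certificate, no named fact, no `sorry`.  HONEST FRAMING: `HC_CM` is NOT proved; nothing here is a period.

THE SETTING.  `G` finite, `c` a central involution, `λ` a linear functional on `𝔽₂[types]` killing the pairs and `G`-invariant on
the Hodge lattice mod `2` (e.g. any functional killing `rad2`).  Its coboundaries `κ_Q = λ∘(·Q⁻¹) − λ` (`cob`) kill `hodge2`, so each
has a well-defined GRADIENT at every place (`cgrad`: `κ_Q[Φ^{(t)}] + κ_Q[Φ]` does not depend on the type `Φ`,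
`apply_flip_add_indep`), and a functional killing `hodge2` with zero gradient is a multiple of the total mass
(`apply_single_eq_of_flat`, `mass`).
* §3 **(E1) the gradient cocycle has a potential**: `c_{QQ′}(t) = c_Q(tQ′⁻¹) + c_{Q′}(t)` (`cgrad_mul`), whence
  `c_Q(t) = μ(t) + μ(tQ⁻¹)` with `μ(t) = c_{t⁻¹}(1)` (`cgrad_eq_pot_add_pot`), a function of the PLACE of `t` (`pot_cmul`, because
  `κ_c = 0`: `c`-coboundaries are pairs).
* §4 **the correction** `d_μ = Σ_{t ∈ T₀} μ(t)·ts2(·)(t)` (`corr`) has gradient `μ` and is constant on `hodge2`; so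
  `λ′ = λ + d_μ` has FLAT coboundaries: **`λ′(v·Q⁻¹) = λ′(v) + e(Q)·mass(v)` with `e : G → 𝔽₂` additive and `e(c) = Σ_{T₀} μ`**
  (`exists_hom_of_potential`).
* §5 **(E2)** (lit-andre-3 g18, PORTFOLIO §1): if `|G|/2` is even then `Σ_{T₀} μ = 0` (`sum_pot_eq_zero_of_even`) — otherwise
  `ker e` is a complement of `c`, part XII supplies an involution `b ∈ ker e`, a half-set and the mixed type `Ψ₀` with
  `Ψ₀·(bc)⁻¹ = Ψ₀`, while `e(bc) = 1` forces `λ′[Ψ₀·(bc)⁻¹] ≠ λ′[Ψ₀]`.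
Part X (`Census/HalfParityLaw.lean`) concludes: `λ′` is a parity combination (`e = 0`) or an `H = ker e`-liftable functional, so
by VIII it kills `hodge2 ∩ ker par2 ∩ ker hpi`; hence `hodge2 ∩ ker par2 ∩ ker hpi ≤ rad2` and **`φ₂ + 1 + δ = β + t`**.

## References
* [Pohlmann1968] H. Pohlmann, Algebraic cycles on abelian varieties of complex multiplication type, Ann. of Math. 88 (1968), Thm 1.
-/

namespace Summit.HodgeConjecture.CorCM.Census.HalfParity

open Finset
open Summit.HodgeConjecture.CorCM.Prior.AllgGroup.RfwfAllgGroup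
open Summit.HodgeConjecture.CorCM.Census.BlockParity
open Summit.HodgeConjecture.CorCM.Census.Coinvariant

noncomputable section

variable {G : Type*} [Group G] [Fintype G] [DecidableEq G] (c : G)

/-! ## §1 Small identities in `𝔽₂` and the total mass -/

omit [Group G] [Fintype G] [DecidableEq G] in
/-- In `𝔽₂`, `x = y + z → y = x + z`. [folklore] -/
theorem eq_add_of_eq_add_two {x y z : ZMod 2} (h : x = y + z) : y = x + z := by
  revert x y z; decide

omit [Group G] [Fintype G] [DecidableEq G] in
/-- In `𝔽₂`, `a + b = e → a = b + e`. [folklore] -/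
theorem eq_add_of_add_eq_two {a b e : ZMod 2} (h : a + b = e) : a = b + e := by
  revert a b e; decide

omit [Fintype G] in
/-- Places are symmetric: `x ∈ {y, cy} ↔ y ∈ {x, cx}`. [folklore] -/
theorem mem_orb_comm (hc2 : c * c = 1) (x y : G) : x ∈ orb c y ↔ y ∈ orb c x := by
  rw [mem_orb, mem_orb]
  constructor
  · rintro (rfl | rfl)
    · exact Or.inl rfl
    · exact Or.inr (by rw [cmul_cmul c hc2])
  · rintro (rfl | rfl)
    · exact Or.inl rfl
    · exact Or.inr (by rw [cmul_cmul c hc2])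

/-- **The total mass** `Σ_Ψ v(Ψ)` of a vector of `𝔽₂[types]`. [folklore] -/
def mass : (CMF G c →₀ ZMod 2) →ₗ[ZMod 2] ZMod 2 := Finsupp.linearCombination (ZMod 2) fun _ => (1 : ZMod 2)

/-- `mass [Ψ]·a = a`. [folklore] -/
@[simp] theorem mass_single (Ψ : CMF G c) (a : ZMod 2) : mass c (Finsupp.single Ψ a) = a := by
  simp [mass, Finsupp.linearCombination_single]

/-- **`mass v = ts2 v (1) + ts2 v (c)`** (the pair identity). [folklore] -/
theorem mass_eq_ts2_add (v : CMF G c →₀ ZMod 2) : mass c v = ts2 c v 1 + ts2 c v c := by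
  induction v using Finsupp.induction_linear with
  | zero => simp
  | add f g hf hg => rw [map_add, hf, hg, map_add, Pi.add_apply, Pi.add_apply]; ring
  | single Ψ a =>
    have h := ts2_add_ts2_cmul c (Finsupp.single Ψ a) 1
    rw [mul_one, Finsupp.sum_single_index rfl] at h
    rw [mass_single, h]

/-- Mass is invariant under relabelling of types. [folklore] -/
theorem mass_mapDomain (f : CMF G c → CMF G c) (v : CMF G c →₀ ZMod 2) : mass c (Finsupp.mapDomain f v) = mass c v := by
  induction v using Finsupp.induction_linear with
  | zero => simp
  | add g h hg hh => rw [Finsupp.mapDomain_add, map_add, map_add, hg, hh]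
  | single Ψ a => rw [Finsupp.mapDomain_single, mass_single, mass_single]

/-- **Hodge vectors mod `2` have mass `0`.** [folklore] -/
theorem mass_eq_zero_of_mem_hodge2 (hc2 : c * c = 1) (hcen : ∀ x : G, x * c = c * x) {v : CMF G c →₀ ZMod 2}
    (hv : v ∈ hodge2 c hc2) : mass c v = 0 := by
  obtain ⟨a, ha⟩ := exists_forall_ts2_eq_of_mem_hodge2 c hc2 hcen hv
  rw [mass_eq_ts2_add, ha, ha, CharTwo.add_self_eq_zero]

/-! ## §2 Functionals killing `hodge2`: the gradient at a place and flatness -/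

/-- The «flip pair» `[Φ^{(s)}] + [Φ] + [Φ′^{(s)}] + [Φ′]` is a Hodge vector mod `2` (its type sum is `2·1_{{s,cs}} = 0`). [folklore] -/
theorem flip_add_flip_mem_hodge2 (hc2 : c * c = 1) (hc1 : c ≠ 1) (hcen : ∀ x : G, x * c = c * x) (s : G) (Φ Φ' : CMF G c) :
    Finsupp.single (oflipCM c hc2 s Φ) (1 : ZMod 2) + Finsupp.single Φ 1 + Finsupp.single (oflipCM c hc2 s Φ') 1 +
      Finsupp.single Φ' 1 ∈ hodge2 c hc2 := by
  refine mem_hodge2_of_forall_ts2_eq c hc2 hc1 hcen (a := 0) fun x => ?_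
  rw [map_add, map_add, map_add, Pi.add_apply, Pi.add_apply, Pi.add_apply, ts2_single_oflipCM, ts2_single_oflipCM]
  have key : ∀ p q o : ZMod 2, p + o + p + (q + o) + q = 0 := by decide
  exact key _ _ _

/-- **The gradient of a functional killing `hodge2` does not depend on the base type**:
`κ[Φ^{(s)}] + κ[Φ] = κ[Φ′^{(s)}] + κ[Φ′]`. [folklore] -/
theorem apply_flip_add_indep (hc2 : c * c = 1) (hc1 : c ≠ 1) (hcen : ∀ x : G, x * c = c * x)
    {κ : (CMF G c →₀ ZMod 2) →ₗ[ZMod 2] ZMod 2} (hκ : hodge2 c hc2 ≤ LinearMap.ker κ) (s : G) (Φ Φ' : CMF G c) :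
    κ (Finsupp.single (oflipCM c hc2 s Φ) 1) + κ (Finsupp.single Φ 1) =
      κ (Finsupp.single (oflipCM c hc2 s Φ') 1) + κ (Finsupp.single Φ' 1) := by
  have h := LinearMap.mem_ker.mp (hκ (flip_add_flip_mem_hodge2 c hc2 hc1 hcen s Φ Φ'))
  rw [map_add, map_add, map_add] at h
  have key : ∀ x y : ZMod 2, x + y = 0 → x = y := by decide
  exact key _ _ (by rw [← h]; ring)

/-- **A flat functional is constant on types**: if `κ[Φ^{(s)}] = κ[Φ]` for all flips then `κ[Ψ] = κ[T₀]` (walk along the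
deviation set). [folklore] -/
theorem apply_single_eq_of_flat (hc2 : c * c = 1) {κ : (CMF G c →₀ ZMod 2) →ₗ[ZMod 2] ZMod 2}
    (hflat : ∀ (s : G) (Φ : CMF G c), κ (Finsupp.single (oflipCM c hc2 s Φ) 1) = κ (Finsupp.single Φ 1)) (T₀ Ψ : CMF G c) :
    κ (Finsupp.single Ψ 1) = κ (Finsupp.single T₀ 1) := by
  suffices h : ∀ n : ℕ, ∀ Ψ : CMF G c, (T₀.1 \ Ψ.1).card = n → κ (Finsupp.single Ψ 1) = κ (Finsupp.single T₀ 1) from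
    h _ Ψ rfl
  intro n
  induction n with
  | zero =>
    intro Ψ h
    rw [Finset.card_eq_zero] at h
    rw [eq_of_dev_empty c h]
  | succ n ih =>
    intro Ψ h
    obtain ⟨s, hs⟩ := Finset.card_pos.mp (by omega : 0 < (T₀.1 \ Ψ.1).card)
    have hsT : s ∈ T₀.1 := (Finset.mem_sdiff.mp hs).1
    have hsΨ : s ∉ Ψ.1 := (Finset.mem_sdiff.mp hs).2
    have hcard : (T₀.1 \ (oflipCM c hc2 s Ψ).1).card = n := by
      rw [dev_oflip c hc2 hsT hsΨ, Finset.card_erase_of_mem hs, h]; rfl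
    rw [← ih _ hcard, ← hflat s (oflipCM c hc2 s Ψ), oflipCM_oflipCM_self]

/-- A functional constant on types is that constant times the mass. [folklore] -/
theorem apply_eq_mul_mass {κ : (CMF G c →₀ ZMod 2) →ₗ[ZMod 2] ZMod 2} {e : ZMod 2} (hconst : ∀ Ψ, κ (Finsupp.single Ψ 1) = e)
    (v : CMF G c →₀ ZMod 2) : κ v = e * mass c v := by
  induction v using Finsupp.induction_linear with
  | zero => simp
  | add f g hf hg => rw [map_add, map_add, hf, hg, mul_add]
  | single Ψ a => rw [← Finsupp.smul_single_one, map_smul, map_smul, hconst, mass_single, smul_eq_mul, smul_eq_mul, mul_one, mul_comm]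

/-! ## §3 (E1) The coboundaries of `λ`, their gradient cocycle, and its potential -/

/-- **The coboundary** `κ_Q = λ∘(·Q⁻¹) − λ` of a functional along a base change. [folklore] -/
def cob (lam : (CMF G c →₀ ZMod 2) →ₗ[ZMod 2] ZMod 2) (Q : G) : (CMF G c →₀ ZMod 2) →ₗ[ZMod 2] ZMod 2 :=
  lam ∘ₗ Finsupp.lmapDomain (ZMod 2) (ZMod 2) (rt c Q) - lam

/-- `κ_Q(v) = λ(v·Q⁻¹) + λ(v)` (characteristic `2`). [folklore] -/
theorem cob_apply (lam : (CMF G c →₀ ZMod 2) →ₗ[ZMod 2] ZMod 2) (Q : G) (v : CMF G c →₀ ZMod 2) :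
    cob c lam Q v = lam (Finsupp.mapDomain (rt c Q) v) + lam v := by
  rw [cob, LinearMap.sub_apply, LinearMap.comp_apply, Finsupp.lmapDomain_apply, sub_eq_add_neg, ZMod.neg_eq_self_mod_two]

/-- `κ` is additive in `λ`. [folklore] -/
theorem cob_add (lam lam' : (CMF G c →₀ ZMod 2) →ₗ[ZMod 2] ZMod 2) (Q : G) : cob c (lam + lam') Q = cob c lam Q + cob c lam' Q := by
  ext v
  simp only [cob, LinearMap.sub_apply, LinearMap.add_apply, LinearMap.comp_apply]
  abel

/-- **The cocycle identity** `κ_{QQ′} = κ_Q∘(·Q′⁻¹) + κ_{Q′}`. [folklore] -/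
theorem cob_mul_apply (lam : (CMF G c →₀ ZMod 2) →ₗ[ZMod 2] ZMod 2) (Q Q' : G) (v : CMF G c →₀ ZMod 2) :
    cob c lam (Q * Q') v = cob c lam Q (Finsupp.mapDomain (rt c Q') v) + cob c lam Q' v := by
  rw [cob_apply, cob_apply, cob_apply, mapDomain_rt_mul]
  have key : ∀ x y z : ZMod 2, x + z = x + y + (y + z) := by decide
  exact key _ _ _

/-- **`κ_c = 0`** when `λ` kills the pairs: a `c`-coboundary is a sum of pairs (part VII). [folklore] -/
theorem cob_self_apply {lam : (CMF G c →₀ ZMod 2) →ₗ[ZMod 2] ZMod 2} (hpair : pair2 c ≤ LinearMap.ker lam)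
    (v : CMF G c →₀ ZMod 2) : cob c lam c v = 0 := by
  rw [cob, LinearMap.sub_apply, LinearMap.comp_apply, Finsupp.lmapDomain_apply, ← map_sub]
  exact LinearMap.mem_ker.mp (hpair (mapDomain_rt_self_sub_mem_pair2 c v))

/-- **Coboundaries of a functional that is invariant on `hodge2` kill `hodge2`.** [folklore] -/
theorem hodge2_le_ker_cob (hc2 : c * c = 1) {lam : (CMF G c →₀ ZMod 2) →ₗ[ZMod 2] ZMod 2}
    (hinv : ∀ (Q : G), ∀ v ∈ hodge2 c hc2, lam (Finsupp.mapDomain (rt c Q) v) = lam v) (Q : G) :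
    hodge2 c hc2 ≤ LinearMap.ker (cob c lam Q) := fun v hv => by
  rw [LinearMap.mem_ker, cob_apply, hinv Q v hv, CharTwo.add_self_eq_zero]

/-- **The gradient** of `κ_Q` at the place of `t`, read at the base type `T₀`. [folklore] -/
def cgrad (hc2 : c * c = 1) (lam : (CMF G c →₀ ZMod 2) →ₗ[ZMod 2] ZMod 2) (T₀ : CMF G c) (Q t : G) : ZMod 2 :=
  cob c lam Q (Finsupp.single (oflipCM c hc2 t T₀) 1) + cob c lam Q (Finsupp.single T₀ 1)

section Cocycle

variable (hc2 : c * c = 1) (hc1 : c ≠ 1) (hcen : ∀ x : G, x * c = c * x) {lam : (CMF G c →₀ ZMod 2) →ₗ[ZMod 2] ZMod 2}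
  (hpair : pair2 c ≤ LinearMap.ker lam) (hinv : ∀ (Q : G), ∀ v ∈ hodge2 c hc2, lam (Finsupp.mapDomain (rt c Q) v) = lam v)
  (T₀ : CMF G c)

include hc1 hcen hinv in
/-- The gradient may be read at any base type. [folklore] -/
theorem cgrad_eq_of_base (Q t : G) (Φ : CMF G c) :
    cgrad c hc2 lam T₀ Q t = cob c lam Q (Finsupp.single (oflipCM c hc2 t Φ) 1) + cob c lam Q (Finsupp.single Φ 1) :=
  apply_flip_add_indep c hc2 hc1 hcen (hodge2_le_ker_cob c hc2 hinv Q) t T₀ Φ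

/-- The gradient is a function of the place: `c_Q(ct) = c_Q(t)`. [folklore] -/
theorem cgrad_cmul (Q t : G) : cgrad c hc2 lam T₀ Q (c * t) = cgrad c hc2 lam T₀ Q t := by
  rw [cgrad, cgrad, oflipCM_cmul]

include hc1 hcen hinv in
/-- **The cocycle identity for gradients**: `c_{QQ′}(t) = c_Q(tQ′⁻¹) + c_{Q′}(t)`. [folklore] -/
theorem cgrad_mul (Q Q' t : G) : cgrad c hc2 lam T₀ (Q * Q') t = cgrad c hc2 lam T₀ Q (t * Q'⁻¹) + cgrad c hc2 lam T₀ Q' t := by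
  rw [cgrad, cob_mul_apply, cob_mul_apply, Finsupp.mapDomain_single, Finsupp.mapDomain_single, rt_oflipCM c hc2,
    cgrad_eq_of_base c hc2 hc1 hcen hinv T₀ Q (t * Q'⁻¹) (rt c Q' T₀), cgrad]
  ring

include hpair in
/-- `c_c = 0`. [folklore] -/
theorem cgrad_self (t : G) : cgrad c hc2 lam T₀ c t = 0 := by
  rw [cgrad, cob_self_apply c hpair, cob_self_apply c hpair, add_zero]

include hc1 hcen hinv in
/-- **(E1) THE POTENTIAL**: `c_Q(t) = μ(t) + μ(tQ⁻¹)` with `μ(t) := c_{t⁻¹}(1)`. [folklore] -/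
theorem cgrad_eq_pot_add_pot (Q t : G) :
    cgrad c hc2 lam T₀ Q t = cgrad c hc2 lam T₀ t⁻¹ 1 + cgrad c hc2 lam T₀ (t * Q⁻¹)⁻¹ 1 := by
  have h := cgrad_mul c hc2 hc1 hcen hinv T₀ Q t⁻¹ 1
  rw [inv_inv, one_mul] at h
  rw [mul_inv_rev, inv_inv, add_comm]
  exact eq_add_of_eq_add_two h

include hc1 hcen hpair hinv in
/-- **The potential is a place function**: `μ(ct) = μ(t)` (because `κ_c = 0`). [folklore] -/
theorem pot_cmul (t : G) : cgrad c hc2 lam T₀ (c * t)⁻¹ 1 = cgrad c hc2 lam T₀ t⁻¹ 1 := by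
  rw [mul_inv_rev, cgrad_mul c hc2 hc1 hcen hinv T₀, inv_eq_self' c hc2, cgrad_self c hc2 hpair T₀, add_zero, one_mul,
    inv_eq_self' c hc2]
  have h := cgrad_cmul c hc2 (lam := lam) T₀ t⁻¹ 1
  rw [mul_one] at h
  exact h

end Cocycle

/-! ## §4 The correction `d_μ` and the normal form of `λ + d_μ` -/

/-- **The correction functional** `d_μ(v) = Σ_{t ∈ T₀} μ(t)·ts2(v)(t)` of a place function `μ`. [folklore] -/
def corr (T₀ : CMF G c) (μ : G → ZMod 2) : (CMF G c →₀ ZMod 2) →ₗ[ZMod 2] ZMod 2 :=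
  (∑ t ∈ T₀.1, μ t • LinearMap.proj (R := ZMod 2) (φ := fun _ : G => ZMod 2) t) ∘ₗ ts2 c

/-- The formula for `d_μ`. [folklore] -/
theorem corr_apply (T₀ : CMF G c) (μ : G → ZMod 2) (v : CMF G c →₀ ZMod 2) :
    corr c T₀ μ v = ∑ t ∈ T₀.1, μ t * ts2 c v t := by
  simp only [corr, LinearMap.coe_comp, Function.comp_apply, LinearMap.sum_apply, LinearMap.smul_apply, LinearMap.proj_apply,
    smul_eq_mul]

/-- **`d_μ` has gradient `μ`**: `d_μ[Φ^{(s)}] + d_μ[Φ] = μ(s)` for a place function `μ`. [folklore] -/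
theorem corr_flip (hc2 : c * c = 1) (hc1 : c ≠ 1) (T₀ : CMF G c) {μ : G → ZMod 2} (hμc : ∀ t, μ (c * t) = μ t) (s : G)
    (Φ : CMF G c) : corr c T₀ μ (Finsupp.single (oflipCM c hc2 s Φ) 1) + corr c T₀ μ (Finsupp.single Φ 1) = μ s := by
  rw [corr_apply, corr_apply, ← Finset.sum_add_distrib]
  have key : ∀ m a o : ZMod 2, m * (a + o) + m * a = m * o := by decide
  have e : ∀ t ∈ T₀.1, μ t * ts2 c (Finsupp.single (oflipCM c hc2 s Φ) 1) t + μ t * ts2 c (Finsupp.single Φ 1) t =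
      μ t * (if s ∈ orb c t then 1 else 0) := fun t _ => by
    rw [ts2_single_oflipCM, key]
    by_cases h : t ∈ orb c s
    · rw [if_pos h, if_pos ((mem_orb_comm c hc2 t s).mp h)]
    · rw [if_neg h, if_neg (fun h' => h ((mem_orb_comm c hc2 s t).mp h'))]
  rw [Finset.sum_congr rfl e, sum_mul_ite_mem_orb c hc2 hc1 T₀ μ s]
  split_ifs
  · rfl
  · exact hμc s

/-- **`d_μ` is invariant on `hodge2`**: `d_μ(v·Q⁻¹) = d_μ(v)` for a Hodge vector `v`. [folklore] -/
theorem corr_mapDomain_rt_of_mem_hodge2 (hc2 : c * c = 1) (hcen : ∀ x : G, x * c = c * x) (T₀ : CMF G c) (μ : G → ZMod 2)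
    (Q : G) {v : CMF G c →₀ ZMod 2} (hv : v ∈ hodge2 c hc2) :
    corr c T₀ μ (Finsupp.mapDomain (rt c Q) v) = corr c T₀ μ v := by
  obtain ⟨a, ha⟩ := exists_forall_ts2_eq_of_mem_hodge2 c hc2 hcen hv
  rw [corr_apply, corr_apply]
  exact Finset.sum_congr rfl fun t _ => by rw [ts2_mapDomain_rt, ha, ha]

/-- `d_μ` of a Hodge vector with type sum `a` is `a·Σ_{T₀} μ`. [folklore] -/
theorem corr_eq_of_forall_ts2_eq (T₀ : CMF G c) (μ : G → ZMod 2) {v : CMF G c →₀ ZMod 2} {a : ZMod 2}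
    (ha : ∀ x, ts2 c v x = a) : corr c T₀ μ v = a * ∑ t ∈ T₀.1, μ t := by
  rw [corr_apply, Finset.mul_sum]
  exact Finset.sum_congr rfl fun t _ => by rw [ha, mul_comm]

/-- `d_μ` of a pair is `Σ_{T₀} μ`. [folklore] -/
theorem corr_red_pair (hcen : ∀ x : G, x * c = c * x) (T₀ : CMF G c) (μ : G → ZMod 2) (Ψ : CMF G c) :
    corr c T₀ μ (red c (pair c Ψ)) = ∑ t ∈ T₀.1, μ t := by
  rw [corr_eq_of_forall_ts2_eq c T₀ μ (a := 1) (fun x => ts2_red_pair c hcen Ψ x), one_mul]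

section NormalForm

variable (hc2 : c * c = 1) (hc1 : c ≠ 1) (hcen : ∀ x : G, x * c = c * x) {lam : (CMF G c →₀ ZMod 2) →ₗ[ZMod 2] ZMod 2}
  (hpair : pair2 c ≤ LinearMap.ker lam) (hinv : ∀ (Q : G), ∀ v ∈ hodge2 c hc2, lam (Finsupp.mapDomain (rt c Q) v) = lam v)
  (T₀ : CMF G c) {μ : G → ZMod 2} (hμ : ∀ Q t, cgrad c hc2 lam T₀ Q t = μ t + μ (t * Q⁻¹)) (hμc : ∀ t, μ (c * t) = μ t)

include hc1 hcen hinv hμ hμc in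
/-- **The corrected functional `λ′ = λ + d_μ` has FLAT coboundaries.** [folklore] -/
theorem cob_add_corr_flat (Q s : G) (Φ : CMF G c) :
    cob c (lam + corr c T₀ μ) Q (Finsupp.single (oflipCM c hc2 s Φ) 1) = cob c (lam + corr c T₀ μ) Q (Finsupp.single Φ 1) := by
  have key0 : ∀ x y : ZMod 2, x + y = 0 → x = y := by decide
  apply key0
  rw [cob_add, LinearMap.add_apply, LinearMap.add_apply]
  have h1 : cob c lam Q (Finsupp.single (oflipCM c hc2 s Φ) 1) + cob c lam Q (Finsupp.single Φ 1) = μ s + μ (s * Q⁻¹) := by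
    rw [← cgrad_eq_of_base c hc2 hc1 hcen hinv T₀ Q s Φ, hμ]
  have h2 : cob c (corr c T₀ μ) Q (Finsupp.single (oflipCM c hc2 s Φ) 1) + cob c (corr c T₀ μ) Q (Finsupp.single Φ 1) =
      μ (s * Q⁻¹) + μ s := by
    rw [cob_apply, cob_apply, Finsupp.mapDomain_single, Finsupp.mapDomain_single, rt_oflipCM c hc2]
    have e1 := corr_flip c hc2 hc1 T₀ hμc (s * Q⁻¹) (rt c Q Φ)
    have e2 := corr_flip c hc2 hc1 T₀ hμc s Φ
    have key : ∀ a b x y p q : ZMod 2, a + b = p → x + y = q → a + x + (b + y) = p + q := by decide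
    exact key _ _ _ _ _ _ e1 e2
  have key : ∀ a b x y p q : ZMod 2, a + b = p + q → x + y = q + p → a + x + (b + y) = 0 := by decide
  exact key _ _ _ _ _ _ h1 h2

include hc1 hcen hpair hinv hμ hμc in
/-- **THE NORMAL FORM.**  `λ′ = λ + d_μ` satisfies `λ′(v·Q⁻¹) = λ′(v) + e(Q)·mass(v)` for an ADDITIVE `e : G → 𝔽₂` with
`e(c) = Σ_{t ∈ T₀} μ(t)`. [folklore] -/
theorem exists_hom_of_potential :
    ∃ e : G → ZMod 2, (∀ (Q : G) (v : CMF G c →₀ ZMod 2),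
        (lam + corr c T₀ μ) (Finsupp.mapDomain (rt c Q) v) = (lam + corr c T₀ μ) v + e Q * mass c v) ∧
      (∀ Q Q' : G, e (Q * Q') = e Q + e Q') ∧ e c = ∑ t ∈ T₀.1, μ t := by
  set lam' := lam + corr c T₀ μ with hlam'
  have hconst : ∀ (Q : G) (Ψ : CMF G c), cob c lam' Q (Finsupp.single Ψ 1) = cob c lam' Q (Finsupp.single T₀ 1) :=
    fun Q Ψ => apply_single_eq_of_flat c hc2 (fun s Φ => cob_add_corr_flat c hc2 hc1 hcen hinv T₀ hμ hμc Q s Φ) T₀ Ψ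
  refine ⟨fun Q => cob c lam' Q (Finsupp.single T₀ 1), fun Q v => ?_, fun Q Q' => ?_, ?_⟩
  · beta_reduce
    have h := apply_eq_mul_mass c (hconst Q) v
    rw [cob_apply] at h
    exact eq_add_of_add_eq_two h
  · beta_reduce
    rw [cob_mul_apply, Finsupp.mapDomain_single, hconst Q]
  · beta_reduce
    rw [cob_apply, Finsupp.mapDomain_single, ← map_add, add_comm, ← red_pair, hlam', LinearMap.add_apply,
      LinearMap.mem_ker.mp (hpair (red_mem_pair2 c (Submodule.subset_span (pair_mem_pairSet c T₀)))), zero_add,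
      corr_red_pair c hcen]

/-! ## §5 (E2) For `|G|/2` even the potential has even weight -/

include hc1 hcen hpair hinv hμ hμc in
/-- **(E2)** If `|G|/2` is even then `Σ_{t ∈ T₀} μ(t) = 0`: otherwise `ker e` is a complement of `c` containing an involution
`b` (part XII), the mixed type `Ψ₀` of a half-set is fixed by `(bc)⁻¹`, and `e(bc) = 1` contradicts the normal form at `[Ψ₀]`.
[folklore] -/
theorem sum_pot_eq_zero_of_even (heven : Even (Fintype.card G / 2)) : ∑ t ∈ T₀.1, μ t = 0 := by
  by_contra hne
  have two1 : ∀ x : ZMod 2, x ≠ 0 → x = 1 := by decide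
  have hw : ∑ t ∈ T₀.1, μ t = 1 := two1 _ hne
  obtain ⟨e, he, hadd, hec⟩ := exists_hom_of_potential c hc2 hc1 hcen hpair hinv T₀ hμ hμc
  rw [hw] at hec
  have he1 : e 1 = 0 := by
    have h := hadd 1 1
    rw [mul_one] at h
    have key : ∀ x : ZMod 2, x = x + x → x = 0 := by decide
    exact key _ h
  let A : Subgroup G :=
    { carrier := {g | e g = 0}
      mul_mem' := fun {a b} ha hb => by
        simp only [Set.mem_setOf_eq] at ha hb ⊢
        rw [hadd, ha, hb, add_zero]
      one_mem' := he1
      inv_mem' := fun {a} ha => by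
        simp only [Set.mem_setOf_eq] at ha ⊢
        have h := hadd a a⁻¹
        rw [mul_inv_cancel, he1, ha, zero_add] at h
        exact h.symm }
  have hmemA : ∀ g, g ∈ A ↔ e g = 0 := fun g => Iff.rfl
  have hA : ∀ x : G, x ∈ A ↔ c * x ∉ A := fun x => by
    rw [hmemA, hmemA, hadd, hec]
    have key : ∀ y : ZMod 2, y = 0 ↔ ¬ 1 + y = 0 := by decide
    exact key _
  obtain ⟨b, hb, hb2, hb1⟩ := exists_mem_cpl_mul_self_eq_one c hc2 hA heven
  obtain ⟨S₀, hS, hS₀⟩ := exists_halfSet c hA hb hb2 hb1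
  have hfix : rt c (b * c) (mixT c hc2 hA S₀ hS) = mixT c hc2 hA S₀ hS := by
    rw [rt_mul, ← rt_mixT c hc2 hcen hA hb hS hS₀, ← rt_mul, hb2, rt_one]
  have h := he (b * c) (Finsupp.single (mixT c hc2 hA S₀ hS) 1)
  rw [Finsupp.mapDomain_single, hfix, mass_single, mul_one, hadd, hec, (hmemA b).mp hb, zero_add] at h
  have key : ∀ x : ZMod 2, x = x + 1 → False := by decide
  exact key _ h

end NormalForm

end

end Summit.HodgeConjecture.CorCM.Census.HalfParity
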